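import Summits.CriticalPhenomena.PercolationContinuityZ3.Theorems.PercNearOneGluingNoHeavyConstsClusterSquareClashPath
import HarnessLib

/-!
# No double clash under the MULTILINKED criterion: cut sets forced on the opposite side

builds on p205010 (kernel theorem, internal audit signed; external expert review pending)

PAPER-2 track "percolation constants", part (ii), seat `prim-consts-1`, gen 17 (lane index
`run/shared/lean/prim/consts/CONSTANTS.md`, row A19; memo `FROM-prim-consts-1-g17-THREE-COPY-STRUCTURE.md` §2b).
Support file for the crux `NoHeavyLowerTail` (stmt-CriticalPhenomena-4575; `--supports`).  Theorems only; no sorries.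

The set-valued form of the linked criteria (`…ClusterSquareLinked`, common cut VERTEX).  In a double clash with cluster `K = C_a(ω)`,
clash vertices `y, y'` and branch vertices `v, v'` (`Consts.exists_branch_of_clash''`) there are eight joining walks ("objects"):
on the `b`-side of `ω` (inside `C_b(ω)`) `y → v` and `v → b`; on the `c`-side of `ω` (inside `C_c(ω)`) `y' → v'` and `v' → c`; on the
`c`-side of `η'` (inside `C_c(η')`) `y → v` and `v → c`; on the `b`-side of `η'` (inside `C_b(η')`) `y' → v'` and `v' → b` — each avoiding
`K` and the listed vertices, and objects on opposite sides of the same configuration are vertex-disjoint.  Hence a datum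
`(K, y, y', v, v')` is refuted by a single closed-set separation of one object (six shapes), or by a SET `Z` which cuts one object `A`
(a closed set containing the start of `A`, not its end, closed under steps into admissible vertices outside `Z`) while every `z ∈ Z`
lies on every admissible realisation of an object `B` on the opposite side of the same configuration (one closed-set certificate per
`z`): if all of `Z` lies on the actual `B`-walk, the actual `A`-walk avoids `Z`.  `Consts.not_doubleClash_of_multilinked` lists the
twenty refutations (6 single, 8 for `ω`, 6 for `η'`); the `Fin n` consequences CSQ/DUU/TS are in `…ClusterSquareMultilinkedFin`.
Census (lane engine `eng/crit12_census.py`, with the near-pendant contractions of `…ClusterSquarePendant`): the criterion coincides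
with "no double clash" on EVERY rooted graph tested — all 21 840 on ≤ 5 vertices, 7 200 on six, 5 460 on seven vertices (sparse and
dense samples) — and is never satisfied when a double clash exists.
Reference: N. Gladkov, arXiv:2408.08457v2 (2024), Thm. 4.3, Def. 4.2, Lemma 3.1, Example 2.5.
-/

noncomputable section

open Classical

namespace Summit.CriticalPhenomena.PercolationContinuityZ3.Theorems

open MeasureTheory Finset Literature.Probability.LatticeModels Literature.Probability.Percolation
open Literature.Probability.Percolation.DecisionTree Literature.Probability.Percolation.BHK2006
open Literature.Probability.Percolation.TargetExploration Literature.Probability.Percolation.ClusterConditioning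

namespace Consts

variable {V : Type*} [Fintype V]

/-- **No double clash under the multilinked criterion** (see the module docstring for the twenty refutation shapes).
[folklore; input for Gladkov2024, Thm. 4.3] -/
theorem not_doubleClash_of_multilinked (H : SimpleGraph V) [DecidableRel H.Adj] (w : Sym2 V → unitInterval) {a b c : V}
    (hH : ∀ u v, u ≠ v → (0 : ℝ) < w s(u, v) → H.Adj u v)
    (hK : ∀ (K : Set V) (y y' v v' : V), a ∈ K → b ∉ K → c ∉ K →
      (∀ T : Set V, a ∈ T → (∀ u x, u ∈ T → H.Adj u x → x ∈ K → x ∈ T) → K ⊆ T) →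
      y ∉ K → y' ∉ K → (∃ k, k ∈ K ∧ H.Adj k y) → (∃ k, k ∈ K ∧ H.Adj k y') →
      y ≠ a → y ≠ b → y ≠ c → y' ≠ a → y' ≠ b → y' ≠ c → y ≠ y' →
      v ∉ K → v' ∉ K → v ≠ a → v ≠ b → v ≠ c → v' ≠ a → v' ≠ b → v' ≠ c → v ≠ v' → v ≠ y' → v' ≠ y →
      3 ≤ H.degree v → 3 ≤ H.degree v' →
      ∃ (S Z : Set V),
        (v ∈ S ∧ b ∉ S ∧ ∀ u x, u ∈ S → H.Adj u x → x ∉ K → x ≠ c → x ≠ v' → x ≠ y' → x ∈ S) ∨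
        (v ∈ S ∧ c ∉ S ∧ ∀ u x, u ∈ S → H.Adj u x → x ∉ K → x ≠ b → x ≠ v' → x ≠ y' → x ∈ S) ∨
        (v' ∈ S ∧ c ∉ S ∧ ∀ u x, u ∈ S → H.Adj u x → x ∉ K → x ≠ b → x ≠ v → x ≠ y → x ∈ S) ∨
        (v' ∈ S ∧ b ∉ S ∧ ∀ u x, u ∈ S → H.Adj u x → x ∉ K → x ≠ c → x ≠ v → x ≠ y → x ∈ S) ∨
        (y ∈ S ∧ v ∉ S ∧ ∀ u x, u ∈ S → H.Adj u x → x ∉ K → x ≠ b → x ≠ c → x ≠ v' → x ≠ y' → x ∈ S) ∨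
        (y' ∈ S ∧ v' ∉ S ∧ ∀ u x, u ∈ S → H.Adj u x → x ∉ K → x ≠ b → x ≠ c → x ≠ v → x ≠ y → x ∈ S) ∨
        ((v ∈ S ∧ b ∉ S ∧ ∀ u x, u ∈ S → H.Adj u x → x ∉ K → x ≠ c → x ≠ v' → x ≠ y' → x ∉ Z → x ∈ S) ∧
          (∀ z ∈ Z, ∃ S' : Set V,
            v' ∈ S' ∧ c ∉ S' ∧ ∀ u x, u ∈ S' → H.Adj u x → x ∉ K → x ≠ b → x ≠ v → x ≠ y → x ≠ z → x ∈ S')) ∨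
        ((v ∈ S ∧ b ∉ S ∧ ∀ u x, u ∈ S → H.Adj u x → x ∉ K → x ≠ c → x ≠ v' → x ≠ y' → x ∉ Z → x ∈ S) ∧
          (∀ z ∈ Z, ∃ S' : Set V,
            y' ∈ S' ∧ v' ∉ S' ∧ ∀ u x, u ∈ S' → H.Adj u x → x ∉ K → x ≠ b → x ≠ c → x ≠ v → x ≠ y → x ≠ z → x ∈ S')) ∨
        ((y ∈ S ∧ v ∉ S ∧ ∀ u x, u ∈ S → H.Adj u x → x ∉ K → x ≠ b → x ≠ c → x ≠ v' → x ≠ y' → x ∉ Z → x ∈ S) ∧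
          (∀ z ∈ Z, ∃ S' : Set V,
            v' ∈ S' ∧ c ∉ S' ∧ ∀ u x, u ∈ S' → H.Adj u x → x ∉ K → x ≠ b → x ≠ v → x ≠ y → x ≠ z → x ∈ S')) ∨
        ((y ∈ S ∧ v ∉ S ∧ ∀ u x, u ∈ S → H.Adj u x → x ∉ K → x ≠ b → x ≠ c → x ≠ v' → x ≠ y' → x ∉ Z → x ∈ S) ∧
          (∀ z ∈ Z, ∃ S' : Set V,
            y' ∈ S' ∧ v' ∉ S' ∧ ∀ u x, u ∈ S' → H.Adj u x → x ∉ K → x ≠ b → x ≠ c → x ≠ v → x ≠ y → x ≠ z → x ∈ S')) ∨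
        ((v' ∈ S ∧ c ∉ S ∧ ∀ u x, u ∈ S → H.Adj u x → x ∉ K → x ≠ b → x ≠ v → x ≠ y → x ∉ Z → x ∈ S) ∧
          (∀ z ∈ Z, ∃ S' : Set V,
            v ∈ S' ∧ b ∉ S' ∧ ∀ u x, u ∈ S' → H.Adj u x → x ∉ K → x ≠ c → x ≠ v' → x ≠ y' → x ≠ z → x ∈ S')) ∨
        ((v' ∈ S ∧ c ∉ S ∧ ∀ u x, u ∈ S → H.Adj u x → x ∉ K → x ≠ b → x ≠ v → x ≠ y → x ∉ Z → x ∈ S) ∧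
          (∀ z ∈ Z, ∃ S' : Set V,
            y ∈ S' ∧ v ∉ S' ∧ ∀ u x, u ∈ S' → H.Adj u x → x ∉ K → x ≠ b → x ≠ c → x ≠ v' → x ≠ y' → x ≠ z → x ∈ S')) ∨
        ((y' ∈ S ∧ v' ∉ S ∧ ∀ u x, u ∈ S → H.Adj u x → x ∉ K → x ≠ b → x ≠ c → x ≠ v → x ≠ y → x ∉ Z → x ∈ S) ∧
          (∀ z ∈ Z, ∃ S' : Set V,
            v ∈ S' ∧ b ∉ S' ∧ ∀ u x, u ∈ S' → H.Adj u x → x ∉ K → x ≠ c → x ≠ v' → x ≠ y' → x ≠ z → x ∈ S')) ∨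
        ((y' ∈ S ∧ v' ∉ S ∧ ∀ u x, u ∈ S → H.Adj u x → x ∉ K → x ≠ b → x ≠ c → x ≠ v → x ≠ y → x ∉ Z → x ∈ S) ∧
          (∀ z ∈ Z, ∃ S' : Set V,
            y ∈ S' ∧ v ∉ S' ∧ ∀ u x, u ∈ S' → H.Adj u x → x ∉ K → x ≠ b → x ≠ c → x ≠ v' → x ≠ y' → x ≠ z → x ∈ S')) ∨
        ((v ∈ S ∧ c ∉ S ∧ ∀ u x, u ∈ S → H.Adj u x → x ∉ K → x ≠ b → x ≠ v' → x ≠ y' → x ∉ Z → x ∈ S) ∧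
          (∀ z ∈ Z, ∃ S' : Set V,
            v' ∈ S' ∧ b ∉ S' ∧ ∀ u x, u ∈ S' → H.Adj u x → x ∉ K → x ≠ c → x ≠ v → x ≠ y → x ≠ z → x ∈ S')) ∨
        ((v ∈ S ∧ c ∉ S ∧ ∀ u x, u ∈ S → H.Adj u x → x ∉ K → x ≠ b → x ≠ v' → x ≠ y' → x ∉ Z → x ∈ S) ∧
          (∀ z ∈ Z, ∃ S' : Set V,
            y' ∈ S' ∧ v' ∉ S' ∧ ∀ u x, u ∈ S' → H.Adj u x → x ∉ K → x ≠ b → x ≠ c → x ≠ v → x ≠ y → x ≠ z → x ∈ S')) ∨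
        ((y ∈ S ∧ v ∉ S ∧ ∀ u x, u ∈ S → H.Adj u x → x ∉ K → x ≠ b → x ≠ c → x ≠ v' → x ≠ y' → x ∉ Z → x ∈ S) ∧
          (∀ z ∈ Z, ∃ S' : Set V,
            v' ∈ S' ∧ b ∉ S' ∧ ∀ u x, u ∈ S' → H.Adj u x → x ∉ K → x ≠ c → x ≠ v → x ≠ y → x ≠ z → x ∈ S')) ∨
        ((v' ∈ S ∧ b ∉ S ∧ ∀ u x, u ∈ S → H.Adj u x → x ∉ K → x ≠ c → x ≠ v → x ≠ y → x ∉ Z → x ∈ S) ∧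
          (∀ z ∈ Z, ∃ S' : Set V,
            v ∈ S' ∧ c ∉ S' ∧ ∀ u x, u ∈ S' → H.Adj u x → x ∉ K → x ≠ b → x ≠ v' → x ≠ y' → x ≠ z → x ∈ S')) ∨
        ((y' ∈ S ∧ v' ∉ S ∧ ∀ u x, u ∈ S → H.Adj u x → x ∉ K → x ≠ b → x ≠ c → x ≠ v → x ≠ y → x ∉ Z → x ∈ S) ∧
          (∀ z ∈ Z, ∃ S' : Set V,
            v ∈ S' ∧ c ∉ S' ∧ ∀ u x, u ∈ S' → H.Adj u x → x ∉ K → x ≠ b → x ≠ v' → x ≠ y' → x ≠ z → x ∈ S')) ∨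
        ((v' ∈ S ∧ b ∉ S ∧ ∀ u x, u ∈ S → H.Adj u x → x ∉ K → x ≠ c → x ≠ v → x ≠ y → x ∉ Z → x ∈ S) ∧
          (∀ z ∈ Z, ∃ S' : Set V,
            y ∈ S' ∧ v ∉ S' ∧ ∀ u x, u ∈ S' → H.Adj u x → x ∉ K → x ≠ b → x ≠ c → x ≠ v' → x ≠ y' → x ≠ z → x ∈ S')))
    {ω η : Set (Sym2 V)} (hω : ∀ e ∈ ω, (0 : ℝ) < w e) (hη : ∀ e ∈ η, (0 : ℝ) < w e)
    (hab : ¬ (openGraph ω).Reachable a b) (hac : ¬ (openGraph ω).Reachable a c) (hbc : ¬ (openGraph ω).Reachable b c)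
    (hbc' : ¬ (openGraph (η \ barOf {a} (setCl ω {a}))).Reachable b c) :
    ¬ ((∃ y k : V, (openGraph ω).Reachable a k ∧ (0 : ℝ) < w s(k, y) ∧ (openGraph ω).Reachable b y ∧
          (openGraph (η \ barOf {a} (setCl ω {a}))).Reachable c y) ∧
       (∃ y k : V, (openGraph ω).Reachable a k ∧ (0 : ℝ) < w s(k, y) ∧ (openGraph ω).Reachable c y ∧
          (openGraph (η \ barOf {a} (setCl ω {a}))).Reachable b y)) := by
  rintro ⟨⟨y, k, hk, hw, hby, hcy⟩, ⟨y', k', hk', hw', hcy', hby'⟩⟩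
  set θ := η \ barOf {a} (setCl ω {a}) with hθdef
  set K : Set V := {x | (openGraph ω).Reachable a x} with hKdef
  have hadjH : ∀ (ξ : Set (Sym2 V)), (∀ e ∈ ξ, (0 : ℝ) < w e) → ∀ u v, (openGraph ξ).Adj u v → H.Adj u v := by
    intro ξ hξ u v huv
    rw [openGraph_adj] at huv
    exact hH u v huv.2 (hξ _ huv.1)
  have hθ : ∀ e ∈ θ, (0 : ℝ) < w e := fun e he => hη e he.1
  have hθK : ∀ u v, (openGraph θ).Adj u v → ¬ (openGraph ω).Reachable a v := by
    intro u v huv hav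
    rw [openGraph_adj, hθdef, barOf_setCl_singleton_eq_cutSet] at huv
    exact huv.1.2 ⟨v, Sym2.mem_mk_right u v, hav⟩
  have hky : H.Adj k y := hH k y (fun h => hab (hk.trans (h ▸ hby.symm))) hw
  have hky' : H.Adj k' y' := hH k' y' (fun h => hac (hk'.trans (h ▸ hcy'.symm))) hw'
  obtain ⟨v, hva, hvb, hvc, hvK, hdv, hbv, hcv, ⟨W, hWb⟩, ⟨W₂, hW₂c⟩⟩ := exists_branch_of_clash'' H (hadjH ω hω) (hadjH _ hθ) hθK
    hab hbc hbc' hk hky hby hcy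
  obtain ⟨v', hva', hvc', hvb', hvK', hdv', hcv', hbv', ⟨W', hWc⟩, ⟨W₂', hW₂b⟩⟩ := exists_branch_of_clash'' H (hadjH ω hω)
    (hadjH _ hθ) hθK hac (fun h => hbc h.symm) (fun h => hbc' h.symm) hk' hky' hcy' hby'
  have hyK : y ∉ K := fun h => hab (h.trans hby.symm)
  have hyK' : y' ∉ K := fun h => hac (h.trans hcy'.symm)
  have hconn : ∀ T : Set V, a ∈ T → (∀ u x, u ∈ T → H.Adj u x → x ∈ K → x ∈ T) → K ⊆ T := by
    intro T haT hT x hx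
    obtain ⟨X⟩ := id hx
    exact mem_of_openWalk_adm H T (fun z => z ∈ K) (fun u z hu huz hz => hT u z hu huz hz) (hadjH ω hω) X haT
      fun z hz => Or.inr (show (openGraph ω).Reachable a z from ⟨X.takeUntil z hz⟩)
  have hωx : ∀ {s t : V} (X : (openGraph ω).Walk s t) (x : V), x ∈ X.support → (openGraph ω).Reachable s x :=
    fun X x hx => ⟨X.takeUntil x hx⟩
  have hθx : ∀ {s t : V} (X : (openGraph θ).Walk s t) (x : V), x ∈ X.support → (openGraph θ).Reachable s x :=
    fun X x hx => ⟨X.takeUntil x hx⟩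
  -- what membership of the four clusters entails
  have hCb : ∀ x, (openGraph ω).Reachable b x → x ∉ K ∧ x ≠ c ∧ x ≠ v' ∧ x ≠ y' := fun x hbx =>
    ⟨fun h => hab (h.trans hbx.symm), fun h => hbc (by rw [← h]; exact hbx),
      fun h => hbc (hbx.trans (by rw [h]; exact hcv'.symm)), fun h => hbc (hbx.trans (by rw [h]; exact hcy'.symm))⟩
  have hCc : ∀ x, (openGraph ω).Reachable c x → x ∉ K ∧ x ≠ b ∧ x ≠ v ∧ x ≠ y := fun x hcx =>
    ⟨fun h => hac (h.trans hcx.symm), fun h => hbc (by rw [← h]; exact hcx.symm),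
      fun h => hbc (hbv.trans (by rw [← h]; exact hcx.symm)), fun h => hbc (hby.trans (by rw [← h]; exact hcx.symm))⟩
  have hθnotK : ∀ s x, ¬ (openGraph ω).Reachable a s → (openGraph θ).Reachable s x → ¬ (openGraph ω).Reachable a x :=
    fun s x hs ⟨X⟩ => not_reachable_of_mem_support a hθK X hs x X.end_mem_support
  have hCcθ : ∀ x, (openGraph θ).Reachable c x → x ∉ K ∧ x ≠ b ∧ x ≠ v' ∧ x ≠ y' := fun x hcx =>
    ⟨hθnotK c x hac hcx, fun h => hbc' (by rw [← h]; exact hcx.symm),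
      fun h => hbc' (hbv'.trans (by rw [← h]; exact hcx.symm)), fun h => hbc' (hby'.trans (by rw [← h]; exact hcx.symm))⟩
  have hCbθ : ∀ x, (openGraph θ).Reachable b x → x ∉ K ∧ x ≠ c ∧ x ≠ v ∧ x ≠ y := fun x hbx =>
    ⟨hθnotK b x hab hbx, fun h => hbc' (by rw [← h]; exact hbx),
      fun h => hbc' (hbx.trans (by rw [h]; exact hcv.symm)), fun h => hbc' (hbx.trans (by rw [h]; exact hcy.symm))⟩
  -- the six objects as walks
  obtain ⟨X₁⟩ := hbv.symm   -- `ω`: v → b, inside `C_b(ω)`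
  obtain ⟨X₂⟩ := hcv.symm   -- `θ`: v → c, inside `C_c(θ)`
  obtain ⟨X₃⟩ := hcv'.symm  -- `ω`: v' → c, inside `C_c(ω)`
  obtain ⟨X₄⟩ := hbv'.symm  -- `θ`: v' → b, inside `C_b(θ)`
  have hX₁ : ∀ x ∈ X₁.support, (openGraph ω).Reachable b x := fun x hx => hbv.trans (hωx X₁ x hx)
  have hX₂ : ∀ x ∈ X₂.support, (openGraph θ).Reachable c x := fun x hx => hcv.trans (hθx X₂ x hx)
  have hX₃ : ∀ x ∈ X₃.support, (openGraph ω).Reachable c x := fun x hx => hcv'.trans (hωx X₃ x hx)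
  have hX₄ : ∀ x ∈ X₄.support, (openGraph θ).Reachable b x := fun x hx => hbv'.trans (hθx X₄ x hx)
  have hW : ∀ x ∈ W.support, (openGraph ω).Reachable b x ∧ x ≠ b := fun x hx =>
    ⟨hby.trans (hωx W x hx), fun h => hWb (h ▸ hx)⟩
  have hW' : ∀ x ∈ W'.support, (openGraph ω).Reachable c x ∧ x ≠ c := fun x hx =>
    ⟨hcy'.trans (hωx W' x hx), fun h => hWc (h ▸ hx)⟩
  have hW₂ : ∀ x ∈ W₂.support, (openGraph θ).Reachable c x ∧ x ≠ c := fun x hx =>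
    ⟨hcy.trans (hθx W₂ x hx), fun h => hW₂c (h ▸ hx)⟩
  have hW₂' : ∀ x ∈ W₂'.support, (openGraph θ).Reachable b x ∧ x ≠ b := fun x hx =>
    ⟨hby'.trans (hθx W₂' x hx), fun h => hW₂b (h ▸ hx)⟩
  -- generic refutations: a closed set cut by `Z` absorbs the end of a walk avoiding `Z`
  have rO1 : ∀ (S Z : Set V), v ∈ S → b ∉ S →
      (∀ u x, u ∈ S → H.Adj u x → x ∉ K → x ≠ c → x ≠ v' → x ≠ y' → x ∉ Z → x ∈ S) → (∀ x ∈ X₁.support, x ∉ Z) → False :=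
    fun S Z h1 h2 hcl hZ => h2 (mem_of_openWalk_adm H S (fun x => x ∉ K ∧ x ≠ c ∧ x ≠ v' ∧ x ≠ y' ∧ x ∉ Z)
      (fun u x hu hux hx' => hcl u x hu hux hx'.1 hx'.2.1 hx'.2.2.1 hx'.2.2.2.1 hx'.2.2.2.2) (hadjH ω hω) X₁ h1
      fun x hx => Or.inr ⟨(hCb x (hX₁ x hx)).1, (hCb x (hX₁ x hx)).2.1, (hCb x (hX₁ x hx)).2.2.1, (hCb x (hX₁ x hx)).2.2.2, hZ x hx⟩)
  have rO5 : ∀ (S Z : Set V), y ∈ S → v ∉ S →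
      (∀ u x, u ∈ S → H.Adj u x → x ∉ K → x ≠ b → x ≠ c → x ≠ v' → x ≠ y' → x ∉ Z → x ∈ S) → (∀ x ∈ W.support, x ∉ Z) → False :=
    fun S Z h1 h2 hcl hZ => h2 (mem_of_openWalk_adm H S (fun x => x ∉ K ∧ x ≠ b ∧ x ≠ c ∧ x ≠ v' ∧ x ≠ y' ∧ x ∉ Z)
      (fun u x hu hux hx' => hcl u x hu hux hx'.1 hx'.2.1 hx'.2.2.1 hx'.2.2.2.1 hx'.2.2.2.2.1 hx'.2.2.2.2.2) (hadjH ω hω) W h1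
      fun x hx => Or.inr ⟨(hCb x (hW x hx).1).1, (hW x hx).2, (hCb x (hW x hx).1).2.1, (hCb x (hW x hx).1).2.2.1, (hCb x (hW x hx).1).2.2.2, hZ x hx⟩)
  have rO3 : ∀ (S Z : Set V), v' ∈ S → c ∉ S →
      (∀ u x, u ∈ S → H.Adj u x → x ∉ K → x ≠ b → x ≠ v → x ≠ y → x ∉ Z → x ∈ S) → (∀ x ∈ X₃.support, x ∉ Z) → False :=
    fun S Z h1 h2 hcl hZ => h2 (mem_of_openWalk_adm H S (fun x => x ∉ K ∧ x ≠ b ∧ x ≠ v ∧ x ≠ y ∧ x ∉ Z)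
      (fun u x hu hux hx' => hcl u x hu hux hx'.1 hx'.2.1 hx'.2.2.1 hx'.2.2.2.1 hx'.2.2.2.2) (hadjH ω hω) X₃ h1
      fun x hx => Or.inr ⟨(hCc x (hX₃ x hx)).1, (hCc x (hX₃ x hx)).2.1, (hCc x (hX₃ x hx)).2.2.1, (hCc x (hX₃ x hx)).2.2.2, hZ x hx⟩)
  have rO6 : ∀ (S Z : Set V), y' ∈ S → v' ∉ S →
      (∀ u x, u ∈ S → H.Adj u x → x ∉ K → x ≠ b → x ≠ c → x ≠ v → x ≠ y → x ∉ Z → x ∈ S) → (∀ x ∈ W'.support, x ∉ Z) → False :=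
    fun S Z h1 h2 hcl hZ => h2 (mem_of_openWalk_adm H S (fun x => x ∉ K ∧ x ≠ b ∧ x ≠ c ∧ x ≠ v ∧ x ≠ y ∧ x ∉ Z)
      (fun u x hu hux hx' => hcl u x hu hux hx'.1 hx'.2.1 hx'.2.2.1 hx'.2.2.2.1 hx'.2.2.2.2.1 hx'.2.2.2.2.2) (hadjH ω hω) W' h1
      fun x hx => Or.inr ⟨(hCc x (hW' x hx).1).1, (hCc x (hW' x hx).1).2.1, (hW' x hx).2,
        (hCc x (hW' x hx).1).2.2.1, (hCc x (hW' x hx).1).2.2.2, hZ x hx⟩)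
  have rO2 : ∀ (S Z : Set V), v ∈ S → c ∉ S →
      (∀ u x, u ∈ S → H.Adj u x → x ∉ K → x ≠ b → x ≠ v' → x ≠ y' → x ∉ Z → x ∈ S) → (∀ x ∈ X₂.support, x ∉ Z) → False :=
    fun S Z h1 h2 hcl hZ => h2 (mem_of_openWalk_adm H S (fun x => x ∉ K ∧ x ≠ b ∧ x ≠ v' ∧ x ≠ y' ∧ x ∉ Z)
      (fun u x hu hux hx' => hcl u x hu hux hx'.1 hx'.2.1 hx'.2.2.1 hx'.2.2.2.1 hx'.2.2.2.2) (hadjH _ hθ) X₂ h1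
      fun x hx => Or.inr ⟨(hCcθ x (hX₂ x hx)).1, (hCcθ x (hX₂ x hx)).2.1, (hCcθ x (hX₂ x hx)).2.2.1, (hCcθ x (hX₂ x hx)).2.2.2, hZ x hx⟩)
  have rO7 : ∀ (S Z : Set V), y ∈ S → v ∉ S →
      (∀ u x, u ∈ S → H.Adj u x → x ∉ K → x ≠ b → x ≠ c → x ≠ v' → x ≠ y' → x ∉ Z → x ∈ S) → (∀ x ∈ W₂.support, x ∉ Z) → False :=
    fun S Z h1 h2 hcl hZ => h2 (mem_of_openWalk_adm H S (fun x => x ∉ K ∧ x ≠ b ∧ x ≠ c ∧ x ≠ v' ∧ x ≠ y' ∧ x ∉ Z)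
      (fun u x hu hux hx' => hcl u x hu hux hx'.1 hx'.2.1 hx'.2.2.1 hx'.2.2.2.1 hx'.2.2.2.2.1 hx'.2.2.2.2.2) (hadjH _ hθ) W₂ h1
      fun x hx => Or.inr ⟨(hCcθ x (hW₂ x hx).1).1, (hCcθ x (hW₂ x hx).1).2.1, (hW₂ x hx).2,
        (hCcθ x (hW₂ x hx).1).2.2.1, (hCcθ x (hW₂ x hx).1).2.2.2, hZ x hx⟩)
  have rO4 : ∀ (S Z : Set V), v' ∈ S → b ∉ S →
      (∀ u x, u ∈ S → H.Adj u x → x ∉ K → x ≠ c → x ≠ v → x ≠ y → x ∉ Z → x ∈ S) → (∀ x ∈ X₄.support, x ∉ Z) → False :=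
    fun S Z h1 h2 hcl hZ => h2 (mem_of_openWalk_adm H S (fun x => x ∉ K ∧ x ≠ c ∧ x ≠ v ∧ x ≠ y ∧ x ∉ Z)
      (fun u x hu hux hx' => hcl u x hu hux hx'.1 hx'.2.1 hx'.2.2.1 hx'.2.2.2.1 hx'.2.2.2.2) (hadjH _ hθ) X₄ h1
      fun x hx => Or.inr ⟨(hCbθ x (hX₄ x hx)).1, (hCbθ x (hX₄ x hx)).2.1, (hCbθ x (hX₄ x hx)).2.2.1, (hCbθ x (hX₄ x hx)).2.2.2, hZ x hx⟩)
  have rO8 : ∀ (S Z : Set V), y' ∈ S → v' ∉ S →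
      (∀ u x, u ∈ S → H.Adj u x → x ∉ K → x ≠ b → x ≠ c → x ≠ v → x ≠ y → x ∉ Z → x ∈ S) → (∀ x ∈ W₂'.support, x ∉ Z) → False :=
    fun S Z h1 h2 hcl hZ => h2 (mem_of_openWalk_adm H S (fun x => x ∉ K ∧ x ≠ b ∧ x ≠ c ∧ x ≠ v ∧ x ≠ y ∧ x ∉ Z)
      (fun u x hu hux hx' => hcl u x hu hux hx'.1 hx'.2.1 hx'.2.2.1 hx'.2.2.2.1 hx'.2.2.2.2.1 hx'.2.2.2.2.2) (hadjH _ hθ) W₂' h1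
      fun x hx => Or.inr ⟨(hCbθ x (hW₂' x hx).1).1, (hW₂' x hx).2, (hCbθ x (hW₂' x hx).1).2.1,
        (hCbθ x (hW₂' x hx).1).2.2.1, (hCbθ x (hW₂' x hx).1).2.2.2, hZ x hx⟩)
  obtain ⟨S, Z, hS⟩ := hK K y y' v v' (SimpleGraph.Reachable.refl a) hab hac hconn hyK hyK' ⟨k, hk, hky⟩ ⟨k', hk', hky'⟩
    (fun h => hyK (by rw [h]; exact SimpleGraph.Reachable.refl a)) (fun h => hbc' (by rw [← h]; exact hcy.symm))
    (fun h => hbc (by rw [← h]; exact hby)) (fun h => hyK' (by rw [h]; exact SimpleGraph.Reachable.refl a))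
    (fun h => hbc (by rw [← h]; exact hcy'.symm)) (fun h => hbc' (by rw [← h]; exact hby'))
    (fun h => hbc (hby.trans (by rw [h]; exact hcy'.symm))) hvK hvK' hva hvb hvc hva' hvb' hvc'
    (fun h => hbc (hbv.trans (by rw [h]; exact hcv'.symm))) (fun h => hbc (hbv.trans (by rw [h]; exact hcy'.symm)))
    (fun h => hbc (hby.trans (by rw [← h]; exact hcv'.symm))) hdv hdv'
  rcases hS with ⟨h1, h2, hcl⟩ | ⟨h1, h2, hcl⟩ | ⟨h1, h2, hcl⟩ | ⟨h1, h2, hcl⟩ | ⟨h1, h2, hcl⟩ | ⟨h1, h2, hcl⟩ |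
      ⟨⟨h1, h2, hcl⟩, hB⟩ |
      ⟨⟨h1, h2, hcl⟩, hB⟩ |
      ⟨⟨h1, h2, hcl⟩, hB⟩ |
      ⟨⟨h1, h2, hcl⟩, hB⟩ |
      ⟨⟨h1, h2, hcl⟩, hB⟩ |
      ⟨⟨h1, h2, hcl⟩, hB⟩ |
      ⟨⟨h1, h2, hcl⟩, hB⟩ |
      ⟨⟨h1, h2, hcl⟩, hB⟩ |
      ⟨⟨h1, h2, hcl⟩, hB⟩ |
      ⟨⟨h1, h2, hcl⟩, hB⟩ |
      ⟨⟨h1, h2, hcl⟩, hB⟩ |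
      ⟨⟨h1, h2, hcl⟩, hB⟩ |
      ⟨⟨h1, h2, hcl⟩, hB⟩ |
      ⟨⟨h1, h2, hcl⟩, hB⟩
  · exact rO1 S ∅ h1 h2 (fun u x hu hux a0 a1 a2 a3 _ => hcl u x hu hux a0 a1 a2 a3)
      fun x _ hx => hx
  · exact rO2 S ∅ h1 h2 (fun u x hu hux a0 a1 a2 a3 _ => hcl u x hu hux a0 a1 a2 a3)
      fun x _ hx => hx
  · exact rO3 S ∅ h1 h2 (fun u x hu hux a0 a1 a2 a3 _ => hcl u x hu hux a0 a1 a2 a3)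
      fun x _ hx => hx
  · exact rO4 S ∅ h1 h2 (fun u x hu hux a0 a1 a2 a3 _ => hcl u x hu hux a0 a1 a2 a3)
      fun x _ hx => hx
  · exact rO5 S ∅ h1 h2 (fun u x hu hux a0 a1 a2 a3 a4 _ => hcl u x hu hux a0 a1 a2 a3 a4)
      fun x _ hx => hx
  · exact rO6 S ∅ h1 h2 (fun u x hu hux a0 a1 a2 a3 a4 _ => hcl u x hu hux a0 a1 a2 a3 a4)
      fun x _ hx => hx
  · by_cases hall : ∀ z ∈ Z, z ∈ X₃.support
    · exact rO1 S Z h1 h2 hcl fun x hxA hxZ => (fun x hxA hxB => hbc (((hX₁ x hxA)).trans ((hX₃ x hxB)).symm)) x hxA (hall x hxZ)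
    · push Not at hall
      obtain ⟨z, hzZ, hzB⟩ := hall
      obtain ⟨S', h1', h2', hcl'⟩ := hB z hzZ
      exact rO3 S' {z} h1' h2' (fun u x hu hux a0 a1 a2 a3 hxz => hcl' u x hu hux a0 a1 a2 a3
        (fun h => hxz (by rw [h]; exact Set.mem_singleton z))) fun x hx hxz => hzB (by
          rw [Set.mem_singleton_iff] at hxz; rwa [hxz] at hx)
  · by_cases hall : ∀ z ∈ Z, z ∈ W'.support
    · exact rO1 S Z h1 h2 hcl fun x hxA hxZ => (fun x hxA hxB => hbc (((hX₁ x hxA)).trans ((hW' x hxB).1).symm)) x hxA (hall x hxZ)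
    · push Not at hall
      obtain ⟨z, hzZ, hzB⟩ := hall
      obtain ⟨S', h1', h2', hcl'⟩ := hB z hzZ
      exact rO6 S' {z} h1' h2' (fun u x hu hux a0 a1 a2 a3 a4 hxz => hcl' u x hu hux a0 a1 a2 a3 a4
        (fun h => hxz (by rw [h]; exact Set.mem_singleton z))) fun x hx hxz => hzB (by
          rw [Set.mem_singleton_iff] at hxz; rwa [hxz] at hx)
  · by_cases hall : ∀ z ∈ Z, z ∈ X₃.support
    · exact rO5 S Z h1 h2 hcl fun x hxA hxZ => (fun x hxA hxB => hbc (((hW x hxA).1).trans ((hX₃ x hxB)).symm)) x hxA (hall x hxZ)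
    · push Not at hall
      obtain ⟨z, hzZ, hzB⟩ := hall
      obtain ⟨S', h1', h2', hcl'⟩ := hB z hzZ
      exact rO3 S' {z} h1' h2' (fun u x hu hux a0 a1 a2 a3 hxz => hcl' u x hu hux a0 a1 a2 a3
        (fun h => hxz (by rw [h]; exact Set.mem_singleton z))) fun x hx hxz => hzB (by
          rw [Set.mem_singleton_iff] at hxz; rwa [hxz] at hx)
  · by_cases hall : ∀ z ∈ Z, z ∈ W'.support
    · exact rO5 S Z h1 h2 hcl fun x hxA hxZ => (fun x hxA hxB => hbc (((hW x hxA).1).trans ((hW' x hxB).1).symm)) x hxA (hall x hxZ)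
    · push Not at hall
      obtain ⟨z, hzZ, hzB⟩ := hall
      obtain ⟨S', h1', h2', hcl'⟩ := hB z hzZ
      exact rO6 S' {z} h1' h2' (fun u x hu hux a0 a1 a2 a3 a4 hxz => hcl' u x hu hux a0 a1 a2 a3 a4
        (fun h => hxz (by rw [h]; exact Set.mem_singleton z))) fun x hx hxz => hzB (by
          rw [Set.mem_singleton_iff] at hxz; rwa [hxz] at hx)
  · by_cases hall : ∀ z ∈ Z, z ∈ X₁.support
    · exact rO3 S Z h1 h2 hcl fun x hxA hxZ => (fun x hxA hxB => hbc (((hX₁ x hxB)).trans ((hX₃ x hxA)).symm)) x hxA (hall x hxZ)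
    · push Not at hall
      obtain ⟨z, hzZ, hzB⟩ := hall
      obtain ⟨S', h1', h2', hcl'⟩ := hB z hzZ
      exact rO1 S' {z} h1' h2' (fun u x hu hux a0 a1 a2 a3 hxz => hcl' u x hu hux a0 a1 a2 a3
        (fun h => hxz (by rw [h]; exact Set.mem_singleton z))) fun x hx hxz => hzB (by
          rw [Set.mem_singleton_iff] at hxz; rwa [hxz] at hx)
  · by_cases hall : ∀ z ∈ Z, z ∈ W.support
    · exact rO3 S Z h1 h2 hcl fun x hxA hxZ => (fun x hxA hxB => hbc (((hW x hxB).1).trans ((hX₃ x hxA)).symm)) x hxA (hall x hxZ)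
    · push Not at hall
      obtain ⟨z, hzZ, hzB⟩ := hall
      obtain ⟨S', h1', h2', hcl'⟩ := hB z hzZ
      exact rO5 S' {z} h1' h2' (fun u x hu hux a0 a1 a2 a3 a4 hxz => hcl' u x hu hux a0 a1 a2 a3 a4
        (fun h => hxz (by rw [h]; exact Set.mem_singleton z))) fun x hx hxz => hzB (by
          rw [Set.mem_singleton_iff] at hxz; rwa [hxz] at hx)
  · by_cases hall : ∀ z ∈ Z, z ∈ X₁.support
    · exact rO6 S Z h1 h2 hcl fun x hxA hxZ => (fun x hxA hxB => hbc (((hX₁ x hxB)).trans ((hW' x hxA).1).symm)) x hxA (hall x hxZ)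
    · push Not at hall
      obtain ⟨z, hzZ, hzB⟩ := hall
      obtain ⟨S', h1', h2', hcl'⟩ := hB z hzZ
      exact rO1 S' {z} h1' h2' (fun u x hu hux a0 a1 a2 a3 hxz => hcl' u x hu hux a0 a1 a2 a3
        (fun h => hxz (by rw [h]; exact Set.mem_singleton z))) fun x hx hxz => hzB (by
          rw [Set.mem_singleton_iff] at hxz; rwa [hxz] at hx)
  · by_cases hall : ∀ z ∈ Z, z ∈ W.support
    · exact rO6 S Z h1 h2 hcl fun x hxA hxZ => (fun x hxA hxB => hbc (((hW x hxB).1).trans ((hW' x hxA).1).symm)) x hxA (hall x hxZ)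
    · push Not at hall
      obtain ⟨z, hzZ, hzB⟩ := hall
      obtain ⟨S', h1', h2', hcl'⟩ := hB z hzZ
      exact rO5 S' {z} h1' h2' (fun u x hu hux a0 a1 a2 a3 a4 hxz => hcl' u x hu hux a0 a1 a2 a3 a4
        (fun h => hxz (by rw [h]; exact Set.mem_singleton z))) fun x hx hxz => hzB (by
          rw [Set.mem_singleton_iff] at hxz; rwa [hxz] at hx)
  · by_cases hall : ∀ z ∈ Z, z ∈ X₄.support
    · exact rO2 S Z h1 h2 hcl fun x hxA hxZ => (fun x hxA hxB => hbc' (((hX₄ x hxB)).trans ((hX₂ x hxA)).symm)) x hxA (hall x hxZ)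
    · push Not at hall
      obtain ⟨z, hzZ, hzB⟩ := hall
      obtain ⟨S', h1', h2', hcl'⟩ := hB z hzZ
      exact rO4 S' {z} h1' h2' (fun u x hu hux a0 a1 a2 a3 hxz => hcl' u x hu hux a0 a1 a2 a3
        (fun h => hxz (by rw [h]; exact Set.mem_singleton z))) fun x hx hxz => hzB (by
          rw [Set.mem_singleton_iff] at hxz; rwa [hxz] at hx)
  · by_cases hall : ∀ z ∈ Z, z ∈ W₂'.support
    · exact rO2 S Z h1 h2 hcl fun x hxA hxZ => (fun x hxA hxB => hbc' (((hW₂' x hxB).1).trans ((hX₂ x hxA)).symm)) x hxA (hall x hxZ)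
    · push Not at hall
      obtain ⟨z, hzZ, hzB⟩ := hall
      obtain ⟨S', h1', h2', hcl'⟩ := hB z hzZ
      exact rO8 S' {z} h1' h2' (fun u x hu hux a0 a1 a2 a3 a4 hxz => hcl' u x hu hux a0 a1 a2 a3 a4
        (fun h => hxz (by rw [h]; exact Set.mem_singleton z))) fun x hx hxz => hzB (by
          rw [Set.mem_singleton_iff] at hxz; rwa [hxz] at hx)
  · by_cases hall : ∀ z ∈ Z, z ∈ X₄.support
    · exact rO7 S Z h1 h2 hcl fun x hxA hxZ => (fun x hxA hxB => hbc' (((hX₄ x hxB)).trans ((hW₂ x hxA).1).symm)) x hxA (hall x hxZ)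
    · push Not at hall
      obtain ⟨z, hzZ, hzB⟩ := hall
      obtain ⟨S', h1', h2', hcl'⟩ := hB z hzZ
      exact rO4 S' {z} h1' h2' (fun u x hu hux a0 a1 a2 a3 hxz => hcl' u x hu hux a0 a1 a2 a3
        (fun h => hxz (by rw [h]; exact Set.mem_singleton z))) fun x hx hxz => hzB (by
          rw [Set.mem_singleton_iff] at hxz; rwa [hxz] at hx)
  · by_cases hall : ∀ z ∈ Z, z ∈ X₂.support
    · exact rO4 S Z h1 h2 hcl fun x hxA hxZ => (fun x hxA hxB => hbc' (((hX₄ x hxA)).trans ((hX₂ x hxB)).symm)) x hxA (hall x hxZ)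
    · push Not at hall
      obtain ⟨z, hzZ, hzB⟩ := hall
      obtain ⟨S', h1', h2', hcl'⟩ := hB z hzZ
      exact rO2 S' {z} h1' h2' (fun u x hu hux a0 a1 a2 a3 hxz => hcl' u x hu hux a0 a1 a2 a3
        (fun h => hxz (by rw [h]; exact Set.mem_singleton z))) fun x hx hxz => hzB (by
          rw [Set.mem_singleton_iff] at hxz; rwa [hxz] at hx)
  · by_cases hall : ∀ z ∈ Z, z ∈ X₂.support
    · exact rO8 S Z h1 h2 hcl fun x hxA hxZ => (fun x hxA hxB => hbc' (((hW₂' x hxA).1).trans ((hX₂ x hxB)).symm)) x hxA (hall x hxZ)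
    · push Not at hall
      obtain ⟨z, hzZ, hzB⟩ := hall
      obtain ⟨S', h1', h2', hcl'⟩ := hB z hzZ
      exact rO2 S' {z} h1' h2' (fun u x hu hux a0 a1 a2 a3 hxz => hcl' u x hu hux a0 a1 a2 a3
        (fun h => hxz (by rw [h]; exact Set.mem_singleton z))) fun x hx hxz => hzB (by
          rw [Set.mem_singleton_iff] at hxz; rwa [hxz] at hx)
  · by_cases hall : ∀ z ∈ Z, z ∈ W₂.support
    · exact rO4 S Z h1 h2 hcl fun x hxA hxZ => (fun x hxA hxB => hbc' (((hX₄ x hxA)).trans ((hW₂ x hxB).1).symm)) x hxA (hall x hxZ)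
    · push Not at hall
      obtain ⟨z, hzZ, hzB⟩ := hall
      obtain ⟨S', h1', h2', hcl'⟩ := hB z hzZ
      exact rO7 S' {z} h1' h2' (fun u x hu hux a0 a1 a2 a3 a4 hxz => hcl' u x hu hux a0 a1 a2 a3 a4
        (fun h => hxz (by rw [h]; exact Set.mem_singleton z))) fun x hx hxz => hzB (by
          rw [Set.mem_singleton_iff] at hxz; rwa [hxz] at hx)

end Consts

end Summit.CriticalPhenomena.PercolationContinuityZ3.Theorems
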